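import Mathlib.LinearAlgebra.FiniteDimensional.Defs
import Mathlib.LinearAlgebra.Dimension.Finite
import Mathlib.LinearAlgebra.LinearIndependent.Lemmas
import HarnessLib

/-!
# Simultaneous eigencharacters of a family of operators: linear independence, finiteness in
# finite dimension, and transport under semilinear symmetries

Topic `Literature/LinearAlgebra/Semilinear`; namespace `Literature.LinearAlgebra.Semilinear`.
PROOFS file (theorems only; no definition, no named fact).

For a field `L`, an `L`-vector space `V` and an ARBITRARY family of `L`-linear operators
`T : ι → End_L(V)` (no commutativity assumed), call `θ : ι → L` a *simultaneous eigencharacter*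
of `T` if some non-zero `y ∈ V` has `T i y = θ i • y` for every `i`. This file proves:

* `linearIndependent_of_simultaneous_eigenvector` — non-zero simultaneous eigenvectors with
  pairwise distinct eigencharacters are linearly independent (induction on a finite support: apply
  `T i - θ₀ i` for an index `i` separating a second character from `θ₀`; the indexed form of
  Mathlib's one-operator `Module.End.eigenvectors_linearIndependent'`);
* `finite_setOf_simultaneous_eigencharacter`, `ncard_setOf_simultaneous_eigencharacter_le_finrank`
  — if `V` is finite-dimensional, the set of simultaneous eigencharacters is finite, of size at
  most `dim V` (even for infinite `ι`);
* `simultaneous_eigenvector_semilinear_map` — a `σ`-semilinear map `g` commuting with the `T i`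
  sends a simultaneous eigenvector of character `θ` to one of character `σ ∘ θ`;
* `finite_image_comp_of_forall_exists_eigenvector` — hence, in finite dimension, if for every `σ`
  in a set `G` of ring endomorphisms of `L` the character `σ ∘ θ` again occurs in `V` (e.g. because
  `V` carries `σ`-semilinear symmetries commuting with the `T i`), the set `{σ ∘ θ | σ ∈ G}` is
  finite.

This is the linear algebra of the "finitely many `Aut(ℂ)`-conjugates" step in Clozel's proof that
the Hecke field of a regular algebraic cuspidal representation is a number field (Clozel 1990,
Thm. 3.13, proof in §3.5: `^σπ_f` occurs in the same finite-dimensional cohomology for every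
`σ ∈ Aut(ℂ/ℚ(λ))`; Shimura 1971, §3.5 for `GL₂`), used by
`Literature/NumberTheory/Automorphic/ClozelAlgebraicityHeckeFieldSymmetryProofs.lean`.

## References

* L. Clozel, *Motifs et formes automorphes: applications du principe de fonctorialité* (1990),
  Thm. 3.13 and §3.5. [Clozel1990]
* Mathlib, `Module.End.eigenvectors_linearIndependent'` (one operator).

## Design notes

No new definition: "simultaneous eigencharacter" is spelled out as
`∃ y, y ≠ 0 ∧ ∀ i, T i y = θ i • y` everywhere. Semilinearity of `g : V → V` is the explicit
hypothesis `∀ c y, g (c • y) = σ c • g y` for a bare function `σ : L → L` (only its values on the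
eigenvalues matter), so that ring automorphisms, `AlgEquiv`s and `RingHom`s all apply through
coercion. Mathlib searches: `eigenvectors_linearIndependent`, `iInf_maxGenEigenspace` (commuting
families only), `LinearIndependent.set_finite_of_isNoetherian`; no simultaneous-eigenvector
statement for non-commuting families in Mathlib. Nothing restated.
-/

namespace Literature.LinearAlgebra.Semilinear

variable {L : Type*} [Field L] {V : Type*} [AddCommGroup V] [Module L V] {ι : Type*}

/-- **Simultaneous eigenvectors with distinct eigencharacters are linearly independent.** Let
`T : ι → End_L(V)` be any family of operators and `y : κ → V` non-zero vectors with
`T i (y k) = θ k i • y k` for all `k, i`, where the eigencharacters `θ k : ι → L` are pairwise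
distinct (`θ` injective). Then `y` is linearly independent. (For one operator this is Mathlib's
`Module.End.eigenvectors_linearIndependent'`; the proof is the same induction on the support of a
dependence relation, applying `T i - θ k₀ i` for an index `i` at which a second character differs
from `θ k₀`.) [folklore] -/
theorem linearIndependent_of_simultaneous_eigenvector (T : ι → Module.End L V) {κ : Type*}
    {θ : κ → ι → L} (hθ : Function.Injective θ) {y : κ → V} (hy : ∀ k, y k ≠ 0)
    (h : ∀ k i, T i (y k) = θ k i • y k) : LinearIndependent L y := by
  classical
  rw [linearIndependent_iff']
  intro s
  induction s using Finset.induction_on with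
  | empty => intro c _ k hk; exact absurd hk (Finset.notMem_empty k)
  | insert k₀ s hk₀ ih =>
    intro c hc
    -- first, every coefficient other than that of `k₀` vanishes
    have hrest : ∀ k ∈ s, c k = 0 := by
      intro k hk
      have hne : θ k ≠ θ k₀ := fun heq ↦ hk₀ (hθ heq ▸ hk)
      obtain ⟨i, hi⟩ := Function.ne_iff.mp hne
      -- apply `T i - θ k₀ i` to the relation
      have hrel : ∑ k ∈ s, (c k * (θ k i - θ k₀ i)) • y k = 0 := by
        have h1 := congrArg (fun w ↦ T i w - θ k₀ i • w) hc
        simp only [map_sum, map_smul, map_zero, smul_zero, sub_zero, Finset.smul_sum] at h1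
        rw [← Finset.sum_sub_distrib, Finset.sum_insert hk₀] at h1
        have h2 : c k₀ • T i (y k₀) - θ k₀ i • c k₀ • y k₀ = 0 := by
          rw [h, smul_smul, smul_smul, mul_comm, sub_self]
        rw [h2, zero_add] at h1
        rw [← h1]
        refine Finset.sum_congr rfl fun k _ ↦ ?_
        rw [h, smul_smul, smul_smul, mul_sub, mul_comm (θ k₀ i) (c k), sub_smul]
      have h3 := ih (fun k ↦ c k * (θ k i - θ k₀ i)) hrel k hk
      rcases mul_eq_zero.mp h3 with h4 | h4
      · exact h4
      · exact absurd (sub_eq_zero.mp h4) hi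
    -- then the relation reduces to `c k₀ • y k₀ = 0`
    have hk₀c : c k₀ = 0 := by
      rw [Finset.sum_insert hk₀, Finset.sum_eq_zero (fun k hk ↦ by rw [hrest k hk, zero_smul]),
        add_zero] at hc
      exact (smul_eq_zero.mp hc).resolve_right (hy k₀)
    intro k hk
    rcases Finset.mem_insert.mp hk with rfl | hk
    · exact hk₀c
    · exact hrest k hk

/-- **In finite dimension a family of operators has finitely many simultaneous eigencharacters**
(any family, any index type): choosing a non-zero simultaneous eigenvector for each character gives
a linearly independent family indexed by the set of characters
(`linearIndependent_of_simultaneous_eigenvector`), which is therefore finite. [folklore] -/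
theorem finite_setOf_simultaneous_eigencharacter [FiniteDimensional L V]
    (T : ι → Module.End L V) :
    {θ : ι → L | ∃ y : V, y ≠ 0 ∧ ∀ i, T i y = θ i • y}.Finite := by
  set Θ := {θ : ι → L | ∃ y : V, y ≠ 0 ∧ ∀ i, T i y = θ i • y} with hΘ
  choose y hy hTy using fun θ : Θ ↦ θ.2
  have hli : LinearIndependent L y :=
    linearIndependent_of_simultaneous_eigenvector T Subtype.val_injective hy fun θ i ↦ hTy θ i
  exact Set.finite_coe_iff.mp hli.finite

/-- The number of simultaneous eigencharacters of a family of operators on a finite-dimensional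
space is at most its dimension. [folklore] -/
theorem ncard_setOf_simultaneous_eigencharacter_le_finrank [FiniteDimensional L V]
    (T : ι → Module.End L V) :
    {θ : ι → L | ∃ y : V, y ≠ 0 ∧ ∀ i, T i y = θ i • y}.ncard ≤ Module.finrank L V := by
  set Θ := {θ : ι → L | ∃ y : V, y ≠ 0 ∧ ∀ i, T i y = θ i • y} with hΘ
  choose y hy hTy using fun θ : Θ ↦ θ.2
  have hli : LinearIndependent L y :=
    linearIndependent_of_simultaneous_eigenvector T Subtype.val_injective hy fun θ i ↦ hTy θ i
  haveI : Fintype Θ := (finite_setOf_simultaneous_eigencharacter T).fintype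
  rw [Set.ncard_eq_toFinset_card' Θ, Set.toFinset_card]
  exact hli.fintype_card_le_finrank

/-- **Semilinear symmetries transport simultaneous eigenvectors.** If `g : V → V` is
`σ`-semilinear on the line through `y` (`g (c • y) = σ c • g y`) and commutes with the operators
`T i`, and `y` is a simultaneous eigenvector of character `θ`, then `g y` is a simultaneous
eigenvector relation-wise of character `σ ∘ θ`: `T i (g y) = σ (θ i) • g y`. [folklore] -/
theorem simultaneous_eigenvector_semilinear_map (T : ι → Module.End L V) {σ : L → L} {g : V → V}
    {y : V} (hg : ∀ c : L, g (c • y) = σ c • g y) (hcomm : ∀ i, T i (g y) = g (T i y))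
    {θ : ι → L} (h : ∀ i, T i y = θ i • y) (i : ι) : T i (g y) = σ (θ i) • g y := by
  rw [hcomm, h, hg]

/-- **Finitely many conjugates.** Let `V` be finite-dimensional with operators `T i`, `θ` a
function `ι → L`, and `G` a set of self-maps of `L` such that for every `σ ∈ G` the "conjugate
character" `σ ∘ θ` OCCURS in `V` (some non-zero `y` has `T i y = σ (θ i) • y` for all `i`; e.g.
`y = g_σ y₀` for a `σ`-semilinear symmetry `g_σ` commuting with the `T i` and a `θ`-eigenvector
`y₀` with `g_σ y₀ ≠ 0`, by `simultaneous_eigenvector_semilinear_map`). Then the set of conjugate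
characters `{σ ∘ θ | σ ∈ G}` is finite (it consists of simultaneous eigencharacters,
`finite_setOf_simultaneous_eigencharacter`). This is the linear algebra of Clozel 1990, §3.5
(`^σπ_f` occurs in the same finite-dimensional cohomology for all `σ ∈ Aut(ℂ/ℚ(λ))`, so `π_f` has
finitely many conjugates). [folklore] -/
theorem finite_image_comp_of_forall_exists_eigenvector [FiniteDimensional L V]
    (T : ι → Module.End L V) (θ : ι → L) (G : Set (L → L))
    (hocc : ∀ σ ∈ G, ∃ y : V, y ≠ 0 ∧ ∀ i, T i y = σ (θ i) • y) :
    ((fun σ : L → L ↦ σ ∘ θ) '' G).Finite := by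
  refine (finite_setOf_simultaneous_eigencharacter T).subset ?_
  rintro _ ⟨σ, hσ, rfl⟩
  exact hocc σ hσ

/-- The symmetry form of `finite_image_comp_of_forall_exists_eigenvector`: if `y₀ ≠ 0` is a
simultaneous eigenvector of character `θ` and every `σ ∈ G` admits a map `g : V → V`,
`σ`-semilinear on the line through `y₀`, commuting with the `T i` and with `g y₀ ≠ 0`, then
`{σ ∘ θ | σ ∈ G}` is finite. [folklore] -/
theorem finite_image_comp_of_semilinear_symmetry [FiniteDimensional L V]
    (T : ι → Module.End L V) {θ : ι → L} {y₀ : V} (h : ∀ i, T i y₀ = θ i • y₀) (G : Set (L → L))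
    (hsymm : ∀ σ ∈ G, ∃ g : V → V, g y₀ ≠ 0 ∧ (∀ c : L, g (c • y₀) = σ c • g y₀) ∧
      ∀ i, T i (g y₀) = g (T i y₀)) :
    ((fun σ : L → L ↦ σ ∘ θ) '' G).Finite := by
  refine finite_image_comp_of_forall_exists_eigenvector T θ G fun σ hσ ↦ ?_
  obtain ⟨g, hg0, hg, hcomm⟩ := hsymm σ hσ
  exact ⟨g y₀, hg0, simultaneous_eigenvector_semilinear_map T hg hcomm h⟩

end Literature.LinearAlgebra.Semilinear
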